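import Mathlib.NumberTheory.ArithmeticFunction.Misc
import Mathlib.Data.Nat.Factorization.Basic
import Mathlib.Algebra.BigOperators.Ring.Finset
import HarnessLib

/-!
# Euler products over pairs of divisors of `Q = ∏_{p ∈ S} p^K`

Topic `Literature/Barriers/Parity`, sub-namespace `TaoTeravainen`; a bookkeeping tool for the proofs
of Tao–Teräväinen's (5.7) and (5.8) (arXiv:2109.06291, §5), where sums over tuples of moduli
composed of a fixed finite set of primes are "factored as Euler products using (2.11)".
Everything here is PROVED (finite combinatorics of valuations; Mathlib only).

* `primePowerProd S K = ∏_{p ∈ S} p^K`, `factorization_primePowerProd`, `divisorOfExp`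
  (the divisor with prescribed valuations `e : S → {0,…,K}`) and its valuations;
* **`sum_divisors_pair_eq_prod`** — for local weights `F_p(i,j)` in a commutative semiring,
  `∑_{d₁ ∣ Q} ∑_{d₂ ∣ Q} ∏_{p ∈ S} F_p(v_p d₁, v_p d₂) = ∏_{p ∈ S} ∑_{i ≤ K} ∑_{j ≤ K} F_p(i, j)`
  (bijection between pairs of divisors and exponent functions `S → {0,…,K}²`).
[cite: TaoTeravainen2021, §3.1 (2.11); §5 (proofs of (5.7), (5.8))]
-/

open Finset

namespace Literature.Barriers.Parity

namespace TaoTeravainen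

/-- `Q_S(K) = ∏_{p ∈ S} p^K`. [folklore] -/
def primePowerProd (S : Finset ℕ) (K : ℕ) : ℕ :=
  ∏ p ∈ S, p ^ K

/-- `Q_S(K) ≠ 0` for a set of primes `S`. [folklore] -/
theorem primePowerProd_ne_zero {S : Finset ℕ} (hS : ∀ p ∈ S, p.Prime) (K : ℕ) :
    primePowerProd S K ≠ 0 :=
  Finset.prod_ne_zero_iff.mpr fun p hp => pow_ne_zero _ (hS p hp).ne_zero

/-- `v_p(Q_S(K)) = K` for `p ∈ S` and `0` otherwise. [folklore] -/
theorem factorization_primePowerProd {S : Finset ℕ} (hS : ∀ p ∈ S, p.Prime) (K p : ℕ) :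
    (primePowerProd S K).factorization p = if p ∈ S then K else 0 := by
  classical
  unfold primePowerProd
  rw [Nat.factorization_prod fun q hq => pow_ne_zero _ (hS q hq).ne_zero, Finsupp.finsetSum_apply]
  have h : ∀ q ∈ S, (q ^ K).factorization p = if q = p then K else 0 := by
    intro q hq
    rw [(hS q hq).factorization_pow, Finsupp.single_apply]
  rw [Finset.sum_congr rfl h, Finset.sum_ite_eq']

/-- The divisors of `Q_S(K)` are the `∏_{p ∈ S} p^{e_p}` with `e_p ≤ K`: a divisor has all its
prime factors in `S` and all valuations `≤ K`. [folklore] -/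
theorem factorization_le_of_dvd_primePowerProd {S : Finset ℕ} (hS : ∀ p ∈ S, p.Prime) {K d : ℕ}
    (hd : d ∣ primePowerProd S K) (p : ℕ) :
    d.factorization p ≤ (if p ∈ S then K else 0) := by
  rw [← factorization_primePowerProd hS K p]
  exact (Nat.factorization_le_iff_dvd (ne_zero_of_dvd_ne_zero (primePowerProd_ne_zero hS K) hd)
    (primePowerProd_ne_zero hS K)).mpr hd p

/-- The divisor with prescribed valuations `e : S → {0,…,K}`. [folklore] -/
def divisorOfExp (S : Finset ℕ) {K : ℕ} (e : S → Fin (K + 1)) : ℕ :=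
  ∏ p ∈ S.attach, (p : ℕ) ^ ((e p : ℕ))

/-- `divisorOfExp e ≠ 0`. [folklore] -/
theorem divisorOfExp_ne_zero {S : Finset ℕ} (hS : ∀ p ∈ S, p.Prime) {K : ℕ} (e : S → Fin (K + 1)) :
    divisorOfExp S e ≠ 0 :=
  Finset.prod_ne_zero_iff.mpr fun p _ => pow_ne_zero _ (hS p p.2).ne_zero

/-- `v_p(divisorOfExp e) = e_p` on `S`, `0` off `S`. [folklore] -/
theorem factorization_divisorOfExp {S : Finset ℕ} (hS : ∀ p ∈ S, p.Prime) {K : ℕ}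
    (e : S → Fin (K + 1)) (p : ℕ) :
    (divisorOfExp S e).factorization p = if h : p ∈ S then ((e ⟨p, h⟩ : ℕ)) else 0 := by
  classical
  unfold divisorOfExp
  rw [Nat.factorization_prod (fun (q : S) _ => pow_ne_zero _ (hS q q.2).ne_zero),
    Finsupp.finsetSum_apply]
  have h : ∀ q ∈ S.attach, ((q : ℕ) ^ ((e q : ℕ))).factorization p =
      if (q : ℕ) = p then ((e q : ℕ)) else 0 := by
    intro q _
    rw [(hS q q.2).factorization_pow, Finsupp.single_apply]
  rw [Finset.sum_congr rfl h]
  by_cases hp : p ∈ S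
  · rw [dif_pos hp]
    rw [Finset.sum_eq_single ⟨p, hp⟩]
    · simp
    · intro q _ hq
      rw [if_neg]
      intro h'
      exact hq (Subtype.ext h')
    · intro h'
      exact absurd (Finset.mem_attach _ _) h'
  · rw [dif_neg hp]
    refine Finset.sum_eq_zero fun q _ => ?_
    rw [if_neg]
    intro h'
    exact hp (h' ▸ q.2)

/-- `divisorOfExp e ∣ Q_S(K)`. [folklore] -/
theorem divisorOfExp_dvd {S : Finset ℕ} (hS : ∀ p ∈ S, p.Prime) {K : ℕ} (e : S → Fin (K + 1)) :
    divisorOfExp S e ∣ primePowerProd S K := by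
  rw [← Nat.factorization_le_iff_dvd (divisorOfExp_ne_zero hS e) (primePowerProd_ne_zero hS K)]
  intro p
  rw [factorization_divisorOfExp hS e p, factorization_primePowerProd hS K p]
  by_cases hp : p ∈ S
  · rw [dif_pos hp, if_pos hp]
    exact Nat.lt_succ_iff.mp (e ⟨p, hp⟩).isLt
  · rw [dif_neg hp, if_neg hp]

/-- **The Euler product over pairs of divisors of `Q_S(K)`**: for local weights `F_p(i, j)`,
`∑_{d₁, d₂ ∣ Q} ∏_{p ∈ S} F_p(v_p d₁, v_p d₂) = ∏_{p ∈ S} ∑_{i,j ≤ K} F_p(i,j)` (the source's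
"factoring the Euler product using (2.11)" for sums over moduli built from the primes of `S`).
[cite: TaoTeravainen2021, §3.1 (2.11) and §5 (proofs of (5.7), (5.8): "Using Euler products (2.11)")] -/
theorem sum_divisors_pair_eq_prod {R : Type*} [CommSemiring R] {S : Finset ℕ} (hS : ∀ p ∈ S, p.Prime)
    (K : ℕ) (F : ℕ → ℕ → ℕ → R) :
    ∑ d₁ ∈ (primePowerProd S K).divisors, ∑ d₂ ∈ (primePowerProd S K).divisors,
        ∏ p ∈ S, F p (d₁.factorization p) (d₂.factorization p) =
      ∏ p ∈ S, ∑ i ∈ Finset.range (K + 1), ∑ j ∈ Finset.range (K + 1), F p i j := by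
  classical
  set Q := primePowerProd S K with hQ
  have hQ0 : Q ≠ 0 := primePowerProd_ne_zero hS K
  -- rewrite the right side as a sum over exponent functions `e : S → Fin (K+1) × Fin (K+1)`
  have hrhs : ∏ p ∈ S, ∑ i ∈ Finset.range (K + 1), ∑ j ∈ Finset.range (K + 1), F p i j =
      ∏ p : S, ∑ c : Fin (K + 1) × Fin (K + 1), F p c.1 c.2 := by
    rw [← Finset.prod_coe_sort S]
    refine Finset.prod_congr rfl fun p _ => ?_
    rw [← Finset.sum_product', Fintype.sum_prod_type]
    rw [Finset.sum_product]
    rw [← Fin.sum_univ_eq_sum_range (fun i => ∑ j ∈ Finset.range (K + 1), F p i j)]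
    refine Finset.sum_congr rfl fun i _ => ?_
    rw [← Fin.sum_univ_eq_sum_range (fun j => F p i j)]
  rw [hrhs, Finset.prod_univ_sum]
  -- the left side as a sum over the product of divisor sets
  rw [← Finset.sum_product']
  -- bijection between exponent functions and pairs of divisors
  symm
  refine Finset.sum_nbij'
    (fun e => (divisorOfExp S (fun p => (e p).1), divisorOfExp S (fun p => (e p).2)))
    (fun dd => fun p =>
      (⟨min (dd.1.factorization p) K, Nat.lt_succ_of_le (min_le_right _ _)⟩,
        ⟨min (dd.2.factorization p) K, Nat.lt_succ_of_le (min_le_right _ _)⟩)) ?_ ?_ ?_ ?_ ?_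
  · -- maps into pairs of divisors
    intro e _
    rw [Finset.mem_product, Nat.mem_divisors, Nat.mem_divisors]
    exact ⟨⟨divisorOfExp_dvd hS _, hQ0⟩, ⟨divisorOfExp_dvd hS _, hQ0⟩⟩
  · intro dd _
    exact Finset.mem_univ _
  · -- left inverse
    intro e _
    funext p
    have h1 := factorization_divisorOfExp hS (fun q => (e q).1) p
    have h2 := factorization_divisorOfExp hS (fun q => (e q).2) p
    rw [dif_pos p.2] at h1 h2
    ext
    · simp only [h1]
      exact min_eq_left (Nat.lt_succ_iff.mp (e p).1.isLt)
    · simp only [h2]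
      exact min_eq_left (Nat.lt_succ_iff.mp (e p).2.isLt)
  · -- right inverse
    intro dd hdd
    rw [Finset.mem_product, Nat.mem_divisors, Nat.mem_divisors] at hdd
    obtain ⟨⟨h1, -⟩, ⟨h2, -⟩⟩ := hdd
    have key : ∀ d : ℕ, d ∣ Q →
        divisorOfExp S (fun p : S => (⟨min (d.factorization p) K,
          Nat.lt_succ_of_le (min_le_right _ _)⟩ : Fin (K + 1))) = d := by
      intro d hd
      have hd0 : d ≠ 0 := ne_zero_of_dvd_ne_zero hQ0 hd
      refine Nat.eq_of_factorization_eq (divisorOfExp_ne_zero hS _) hd0 fun p => ?_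
      rw [factorization_divisorOfExp hS]
      have hle := factorization_le_of_dvd_primePowerProd hS hd p
      by_cases hp : p ∈ S
      · rw [dif_pos hp]
        rw [if_pos hp] at hle
        exact min_eq_left hle
      · rw [dif_neg hp]
        rw [if_neg hp] at hle
        omega
    exact Prod.ext (key dd.1 h1) (key dd.2 h2)
  · -- the summands agree
    intro e _
    rw [← Finset.prod_coe_sort S]
    refine Finset.prod_congr rfl fun p _ => ?_
    have h1 := factorization_divisorOfExp hS (fun q => (e q).1) p
    have h2 := factorization_divisorOfExp hS (fun q => (e q).2) p
    rw [dif_pos p.2] at h1 h2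
    rw [h1, h2]

end TaoTeravainen

end Literature.Barriers.Parity
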